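import Mathlib
import Summits.Ventures.HodgeRepro.Tier4.Line1.RTFSide
import Summits.Ventures.HodgeRepro.Tier4.Line1.RealisedSetting
import Summits.Ventures.HodgeRepro.Tier4.Line1.CMQuadData
import Summits.Ventures.HodgeRepro.Tier4.Line1.RTFDataOfCharacters

/-!
# Tier4/Line1/CMConclusion — the conclusion of `P_T4` for a datum `d` from LINE L1's inputs ON THE CM FIELD, every
DEFINED object BY NAME (the CM seesaw plane, the RTF data from the characters, the setting with its cocompactness):
the costume `line1_realise d` for the field of the target, with ONLY the free half displayed

Blind re-derivation cell `pub-hodge-repro`, Tier 4 (README §9–§10), seat t4-L1-p3 (gen 2).  Target tree path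
`lean/Summits/Ventures/HodgeRepro/Tier4/Line1/CMConclusion.lean`.  Imports this seat's `RTFSide`
(`conclusion_of_rtf_inputs`), `RealisedSetting` (`Setting.ofAdelic` on p5's `quotient_compact_genuine`, the bridges
`isCharacter_ofAdelic` / `isCharacter'_ofAdelic`), `CMQuadData` (`cmQuad`, `isDefinite_isGenuineRow_ofLinesRow_cmQuad`)
and p4's `RTFDataOfCharacters` (`RTFData.ofCharacters`, `ofCharacters_μT_isHaarMeasure`, `ofCharacters_hT`).

WHAT THIS IS.  `conclusion_of_cm_inputs` specialises `conclusion_of_rtf_inputs` to the CM field `E` of the datum: the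
plane is `ofLinesRow (cmQuad ω h) a b 1` (definite at `σ`, genuine — by name), the RTF data are `RTFData.ofCharacters`
of two characters `χ, χ′` with the seven clauses, the setting is the tree's `Setting.ofAdelic` (its fundamental domain
`DG` by p5's (I1-c)).  What the theorem still takes from outside is EXACTLY the free half of the costume, binder by
binder: the level `Γ′` with the printed cocompactness `hcc`; the theta lifts `Θ` and a side `E₀` on typer-1's concrete
witness; the plane parameters `(ω, a, b, σ)`; the characters `χ, χ′` with the seven clauses and their continuity /
unitarity (the corner characters through the printed identification); a Haar measure `μ`; the DEFINED RTF content as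
INPUTS — an adapted family `(τ, φ, n)` and an isolating pair `(f₁, f₂, o₀)` (`exists_defined_content_ofData` supplies
one; the costume chooses `f₁` with the admissible projector, F2′); the lift clause `Lift` with `hlift` for THAT `f₁`
(F1 + F2); the seesaw components (S1)–(S3) on the RTF-instantiated face.  Nothing in the binders is claimed.
Nothing here says anything about the status of the Hodge conjecture for CM abelian varieties, which is NOT proved
(HC_CM is NOT proved by anyone in this repository).
-/

set_option autoImplicit false

noncomputable section

namespace Summit.Ventures.HodgeRepro.Tier4.Line1

open NumberField Common PeriodCloser MeasureTheory

section CM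

variable {F E : Type} [Field F] [NumberField F] [IsGalois ℚ F] [IsCMField F]
  [Field E] [NumberField E] [IsGalois ℚ E] [IsCMField E]

/-- **The conclusion of `P_T4` for `d` from LINE L1's inputs on the CM field, DEFINED objects by name** — the costume
`line1_realise d` with only its free half displayed (see the module docstring for the reading of each binder). -/
theorem conclusion_of_cm_inputs (d : TargetData F E) {Γ' : Set (Matrix (Fin 3) (Fin 3) E)}
    (hΓ' : d.IsLevel Γ') (hcc : d.IsCocompact Γ')
    {Θ : ThetaLifts (d.concreteWitness hΓ' (isDomain_dom d hΓ').subset_ball (isDomain_dom d hΓ').measurableSet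
      (d.residual_of_cocompact hΓ' hcc))}
    (E₀ : EndoscopicSide E (d.concreteWitness hΓ' (isDomain_dom d hΓ').subset_ball
      (isDomain_dom d hΓ').measurableSet (d.residual_of_cocompact hΓ' hcc)) Θ)
    (ω : E) (hω : ω ≠ 0) (h : IsCMField.complexConj E ω = -ω)
    (a b : maximalRealSubfield E) (ha : a ≠ 0) (hb : b ≠ 0) (σ : maximalRealSubfield E →+* ℝ)
    (hpos : (0 < σ a ∧ 0 < σ b) ∨ (σ a < 0 ∧ σ b < 0))
    [MeasurableSpace (GA (PlaneData.ofLinesRow (cmQuad ω h) a b 1))]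
    [BorelSpace (GA (PlaneData.ofLinesRow (cmQuad ω h) a b 1))]
    (μ : Measure (GA (PlaneData.ofLinesRow (cmQuad ω h) a b 1))) [μ.IsHaarMeasure]
    (chi : torusT (PlaneData.ofLinesRow (cmQuad ω h) a b 1) → ℂ)
    (chi' : torusT' (PlaneData.ofLinesRow (cmQuad ω h) a b 1) → ℂ)
    (hmul : ∀ s t, chi (s * t) = chi s * chi t) (hmul' : ∀ s t, chi' (s * t) = chi' s * chi' t)
    (hrat : ∀ t : torusT (PlaneData.ofLinesRow (cmQuad ω h) a b 1),
      (t : GA (PlaneData.ofLinesRow (cmQuad ω h) a b 1)) ∈ rationalPoints (PlaneData.ofLinesRow (cmQuad ω h) a b 1) →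
        chi t = 1)
    (hrat' : ∀ t : torusT' (PlaneData.ofLinesRow (cmQuad ω h) a b 1),
      (t : GA (PlaneData.ofLinesRow (cmQuad ω h) a b 1)) ∈ rationalPoints (PlaneData.ofLinesRow (cmQuad ω h) a b 1) →
        chi' t = 1)
    (hcentre : ∀ (z : GA (PlaneData.ofLinesRow (cmQuad ω h) a b 1))
      (hz : z ∈ centre (PlaneData.ofLinesRow (cmQuad ω h) a b 1)),
      chi ⟨z, centre_le_torusT _ hz⟩ = chi' ⟨z, centre_le_torusT' _ hz⟩)
    (hc : Continuous chi) (hu : ∀ x, ‖chi x‖ = 1) (hc' : Continuous chi') (hu' : ∀ x, ‖chi' x‖ = 1)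
    {τ : ℕ → Set (GA (PlaneData.ofLinesRow (cmQuad ω h) a b 1) → ℂ)}
    {φ : ℕ → GA (PlaneData.ofLinesRow (cmQuad ω h) a b 1) → ℂ} {n : ℕ → ℕ}
    (hB : haveI := (ofCharacters_μT_isHaarMeasure (PlaneData.ofLinesRow (cmQuad ω h) a b 1)
        (isDefinite_isGenuineRow_ofLinesRow_cmQuad ω hω h a b ha hb σ hpos).1
        (isDefinite_isGenuineRow_ofLinesRow_cmQuad ω hω h a b ha hb σ hpos).2 chi chi' hmul hmul' hrat hrat' hcentre)
      haveI := (ofCharacters_μT'_isHaarMeasure (PlaneData.ofLinesRow (cmQuad ω h) a b 1)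
        (isDefinite_isGenuineRow_ofLinesRow_cmQuad ω hω h a b ha hb σ hpos).1
        (isDefinite_isGenuineRow_ofLinesRow_cmQuad ω hω h a b ha hb σ hpos).2 chi chi' hmul hmul' hrat hrat' hcentre)
      (Setting.ofAdelic (PlaneData.ofLinesRow (cmQuad ω h) a b 1)
        (isDefinite_isGenuineRow_ofLinesRow_cmQuad ω hω h a b ha hb σ hpos).1
        (isDefinite_isGenuineRow_ofLinesRow_cmQuad ω hω h a b ha hb σ hpos).2
        (RTFData.ofCharacters (PlaneData.ofLinesRow (cmQuad ω h) a b 1)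
          (isDefinite_isGenuineRow_ofLinesRow_cmQuad ω hω h a b ha hb σ hpos).1
          (isDefinite_isGenuineRow_ofLinesRow_cmQuad ω hω h a b ha hb σ hpos).2 chi chi' hmul hmul' hrat hrat' hcentre)
        μ
        (ofCharacters_hT _ (isDefinite_isGenuineRow_ofLinesRow_cmQuad ω hω h a b ha hb σ hpos).1
          (isDefinite_isGenuineRow_ofLinesRow_cmQuad ω hω h a b ha hb σ hpos).2 chi chi' hmul hmul' hrat hrat' hcentre)
        (ofCharacters_hT' _ (isDefinite_isGenuineRow_ofLinesRow_cmQuad ω hω h a b ha hb σ hpos).1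
          (isDefinite_isGenuineRow_ofLinesRow_cmQuad ω hω h a b ha hb σ hpos).2 chi chi' hmul hmul' hrat hrat'
          hcentre)).IsAdaptedONB τ φ n)
    {f₁ f₂ : GA (PlaneData.ofLinesRow (cmQuad ω h) a b 1) → ℂ} (h₁ : RTF.IsTest f₁) (h₂ : RTF.IsTest f₂)
    (hconv : haveI := (ofCharacters_μT_isHaarMeasure (PlaneData.ofLinesRow (cmQuad ω h) a b 1)
        (isDefinite_isGenuineRow_ofLinesRow_cmQuad ω hω h a b ha hb σ hpos).1
        (isDefinite_isGenuineRow_ofLinesRow_cmQuad ω hω h a b ha hb σ hpos).2 chi chi' hmul hmul' hrat hrat' hcentre)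
      haveI := (ofCharacters_μT'_isHaarMeasure (PlaneData.ofLinesRow (cmQuad ω h) a b 1)
        (isDefinite_isGenuineRow_ofLinesRow_cmQuad ω hω h a b ha hb σ hpos).1
        (isDefinite_isGenuineRow_ofLinesRow_cmQuad ω hω h a b ha hb σ hpos).2 chi chi' hmul hmul' hrat hrat' hcentre)
      RTF.IsTest ((Setting.ofAdelic (PlaneData.ofLinesRow (cmQuad ω h) a b 1)
        (isDefinite_isGenuineRow_ofLinesRow_cmQuad ω hω h a b ha hb σ hpos).1
        (isDefinite_isGenuineRow_ofLinesRow_cmQuad ω hω h a b ha hb σ hpos).2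
        (RTFData.ofCharacters (PlaneData.ofLinesRow (cmQuad ω h) a b 1)
          (isDefinite_isGenuineRow_ofLinesRow_cmQuad ω hω h a b ha hb σ hpos).1
          (isDefinite_isGenuineRow_ofLinesRow_cmQuad ω hω h a b ha hb σ hpos).2 chi chi' hmul hmul' hrat hrat' hcentre)
        μ
        (ofCharacters_hT _ (isDefinite_isGenuineRow_ofLinesRow_cmQuad ω hω h a b ha hb σ hpos).1
          (isDefinite_isGenuineRow_ofLinesRow_cmQuad ω hω h a b ha hb σ hpos).2 chi chi' hmul hmul' hrat hrat' hcentre)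
        (ofCharacters_hT' _ (isDefinite_isGenuineRow_ofLinesRow_cmQuad ω hω h a b ha hb σ hpos).1
          (isDefinite_isGenuineRow_ofLinesRow_cmQuad ω hω h a b ha hb σ hpos).2 chi chi' hmul hmul' hrat hrat'
          hcentre)).conv f₁ f₂))
    (tl : Θ.U1Char → ℕ) (Lift : ℕ → Prop)
    (base : (d.concreteWitness hΓ' (isDomain_dom d hΓ').subset_ball (isDomain_dom d hΓ').measurableSet
      (d.residual_of_cocompact hΓ' hcc)).Translates)
    (hrest : haveI := (ofCharacters_μT_isHaarMeasure (PlaneData.ofLinesRow (cmQuad ω h) a b 1)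
        (isDefinite_isGenuineRow_ofLinesRow_cmQuad ω hω h a b ha hb σ hpos).1
        (isDefinite_isGenuineRow_ofLinesRow_cmQuad ω hω h a b ha hb σ hpos).2 chi chi' hmul hmul' hrat hrat' hcentre)
      haveI := (ofCharacters_μT'_isHaarMeasure (PlaneData.ofLinesRow (cmQuad ω h) a b 1)
        (isDefinite_isGenuineRow_ofLinesRow_cmQuad ω hω h a b ha hb σ hpos).1
        (isDefinite_isGenuineRow_ofLinesRow_cmQuad ω hω h a b ha hb σ hpos).2 chi chi' hmul hmul' hrat hrat' hcentre)
      let S := (Setting.ofAdelic (PlaneData.ofLinesRow (cmQuad ω h) a b 1)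
        (isDefinite_isGenuineRow_ofLinesRow_cmQuad ω hω h a b ha hb σ hpos).1
        (isDefinite_isGenuineRow_ofLinesRow_cmQuad ω hω h a b ha hb σ hpos).2
        (RTFData.ofCharacters (PlaneData.ofLinesRow (cmQuad ω h) a b 1)
          (isDefinite_isGenuineRow_ofLinesRow_cmQuad ω hω h a b ha hb σ hpos).1
          (isDefinite_isGenuineRow_ofLinesRow_cmQuad ω hω h a b ha hb σ hpos).2 chi chi' hmul hmul' hrat hrat' hcentre)
        μ
        (ofCharacters_hT _ (isDefinite_isGenuineRow_ofLinesRow_cmQuad ω hω h a b ha hb σ hpos).1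
          (isDefinite_isGenuineRow_ofLinesRow_cmQuad ω hω h a b ha hb σ hpos).2 chi chi' hmul hmul' hrat hrat' hcentre)
        (ofCharacters_hT' _ (isDefinite_isGenuineRow_ofLinesRow_cmQuad ω hω h a b ha hb σ hpos).1
          (isDefinite_isGenuineRow_ofLinesRow_cmQuad ω hω h a b ha hb σ hpos).2 chi chi' hmul hmul' hrat hrat'
          hcentre))
      ∃ o₀ : S.Orbit, S.geoSupport (S.conv f₁ f₂) = {o₀} ∧
        S.orbital (RTFData.ofCharacters (PlaneData.ofLinesRow (cmQuad ω h) a b 1)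
          (isDefinite_isGenuineRow_ofLinesRow_cmQuad ω hω h a b ha hb σ hpos).1
          (isDefinite_isGenuineRow_ofLinesRow_cmQuad ω hω h a b ha hb σ hpos).2 chi chi' hmul hmul' hrat hrat'
          hcentre).chi
          (RTFData.ofCharacters (PlaneData.ofLinesRow (cmQuad ω h) a b 1)
          (isDefinite_isGenuineRow_ofLinesRow_cmQuad ω hω h a b ha hb σ hpos).1
          (isDefinite_isGenuineRow_ofLinesRow_cmQuad ω hω h a b ha hb σ hpos).2 chi chi' hmul hmul' hrat hrat'
          hcentre).chi' o₀ (S.conv f₁ f₂) ≠ 0 ∧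
        (∀ m, S.PeriodNonzeroT (RTFData.ofCharacters (PlaneData.ofLinesRow (cmQuad ω h) a b 1)
            (isDefinite_isGenuineRow_ofLinesRow_cmQuad ω hω h a b ha hb σ hpos).1
            (isDefinite_isGenuineRow_ofLinesRow_cmQuad ω hω h a b ha hb σ hpos).2 chi chi' hmul hmul' hrat hrat'
            hcentre).chi (τ m) →
          S.PeriodNonzeroT' (RTFData.ofCharacters (PlaneData.ofLinesRow (cmQuad ω h) a b 1)
            (isDefinite_isGenuineRow_ofLinesRow_cmQuad ω hω h a b ha hb σ hpos).1
            (isDefinite_isGenuineRow_ofLinesRow_cmQuad ω hω h a b ha hb σ hpos).2 chi chi' hmul hmul' hrat hrat'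
            hcentre).chi' (τ m) → S.Hit (RTF.cj f₁) (τ m) → Lift m) ∧
        ∃ Sp : SpectralInterface (sideWithRTFSpectrum E₀ S
            (RTFData.ofCharacters (PlaneData.ofLinesRow (cmQuad ω h) a b 1)
              (isDefinite_isGenuineRow_ofLinesRow_cmQuad ω hω h a b ha hb σ hpos).1
              (isDefinite_isGenuineRow_ofLinesRow_cmQuad ω hω h a b ha hb σ hpos).2 chi chi' hmul hmul' hrat hrat'
              hcentre).chi
            (RTFData.ofCharacters (PlaneData.ofLinesRow (cmQuad ω h) a b 1)
              (isDefinite_isGenuineRow_ofLinesRow_cmQuad ω hω h a b ha hb σ hpos).1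
              (isDefinite_isGenuineRow_ofLinesRow_cmQuad ω hω h a b ha hb σ hpos).2 chi chi' hmul hmul' hrat hrat'
              hcentre).chi' τ tl Lift).toC7Face,
          SeesawComponents _ Sp) :
    d.conclusion := by
  haveI := (ofCharacters_μT_isHaarMeasure (PlaneData.ofLinesRow (cmQuad ω h) a b 1)
    (isDefinite_isGenuineRow_ofLinesRow_cmQuad ω hω h a b ha hb σ hpos).1
    (isDefinite_isGenuineRow_ofLinesRow_cmQuad ω hω h a b ha hb σ hpos).2 chi chi' hmul hmul' hrat hrat' hcentre)
  haveI := (ofCharacters_μT'_isHaarMeasure (PlaneData.ofLinesRow (cmQuad ω h) a b 1)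
    (isDefinite_isGenuineRow_ofLinesRow_cmQuad ω hω h a b ha hb σ hpos).1
    (isDefinite_isGenuineRow_ofLinesRow_cmQuad ω hω h a b ha hb σ hpos).2 chi chi' hmul hmul' hrat hrat' hcentre)
  obtain ⟨o₀, hiso, hne, hlift, hseesaw⟩ := hrest
  exact conclusion_of_rtf_inputs d hΓ' hcc E₀ _
    (isCharacter_ofAdelic _ _ _ _ μ _ _ hc hu) (isCharacter'_ofAdelic _ _ _ _ μ _ _ hc' hu')
    hB h₁ h₂ hconv hiso hne tl Lift base hlift hseesaw

end CM

end Summit.Ventures.HodgeRepro.Tier4.Line1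

end
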